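import Literature.Topology.FourManifolds.CoupleSignSelection
import Literature.Topology.FourManifolds.InverseFunctionTheorem
import Literature.Topology.FourManifolds.FramedTubularNbhd

/-!
# The unit entrance charts as smooth embeddings of the plane into the sphere

Topic `Literature/Topology/FourManifolds` (support of `stmt-SmoothPoincare4-15190`, structure
conjugacy; step (ε4a/b) of the construction of the sphere diffeomorphism).  Everything here is
**proved**.

* `isSmoothEmbedding_of_contMDiffAt_leftInverse` — **a smooth map from a vector space into a boundaryless
  manifold of the same model with a left inverse smooth at the image points is a smooth
  embedding** (injective local diffeomorphism: the differential is invertible by the chain rule,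
  `det_pushFrame_ne_zero_of_comp_eq_id`; inverse function theorem `isLocalDiffeomorphAt_of_mfderiv`;
  `isSmoothEmbedding_of_isLocalDiffeomorph`);
* `BasinPair.SaddleData.ue Q r s b : ℝ² → S²`, `y ↦ unit (entDir s b (shrink_r y))` — **the unit
  entrance chart of the end `b` of `s`, reparametrised by the whole plane** through Mathlib's
  `univBall 0 r` (`r² < ε²`), with left inverse `ueInv` (`ueInv_ue`); it is a smooth embedding
  (`isSmoothEmbedding_ue`), also after a diffeomorphism of the sphere (`isSmoothEmbedding_comp_ue`),
  and `ue 0 = unit (coreDir s b)`.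

## References

* J. M. Lee, *Introduction to Smooth Manifolds* (2013), Thm. 4.5, Prop. 4.8, Prop. 5.2.
  [LeeSmoothManifolds2013]
* J. Milnor, *Lectures on the h-cobordism theorem* (1965), proof of Thm. 3.13. [MilnorHCobordism1965]
-/

open scoped Manifold ContDiff Topology
open Set Function Filter Metric Module

noncomputable section

namespace Literature.Topology.FourManifolds

/-! ### Smooth maps with a smooth left inverse are embeddings -/

section LeftInverse

variable {E : Type*} [NormedAddCommGroup E] [NormedSpace ℝ E] [FiniteDimensional ℝ E]
  {H : Type*} [TopologicalSpace H] {J : ModelWithCorners ℝ E H} [J.Boundaryless]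
  {N : Type*} [TopologicalSpace N] [ChartedSpace H N] [IsManifold J ∞ N]

/-- **A smooth map with a left inverse smooth at the image points is a smooth embedding.** [cite: LeeSmoothManifolds2013, Thm. 4.5, Prop. 4.8, Prop. 5.2] -/
theorem isSmoothEmbedding_of_contMDiffAt_leftInverse {g : E → N} (hg : ContMDiff 𝓘(ℝ, E) J ∞ g) {χ : N → E}
    (hχ : ∀ x, ContMDiffAt J 𝓘(ℝ, E) ∞ χ (g x)) (hid : ∀ x, χ (g x) = x) :
    Manifold.IsSmoothEmbedding 𝓘(ℝ, E) J ∞ g := by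
  haveI : CompleteSpace E := FiniteDimensional.complete ℝ E
  have hinj : Injective g := fun x y h => by rw [← hid x, ← hid y, h]
  have hloc : IsLocalDiffeomorph 𝓘(ℝ, E) J ∞ g := fun x => by
    have hdet : (finBasis ℝ E).det (pushFrame J g x) ≠ 0 :=
      det_pushFrame_ne_zero_of_comp_eq_id ((hg x).mdifferentiableAt (by simp)) ((hχ x).mdifferentiableAt (by simp))
        (Eventually.of_forall fun y => hid y)
    rw [det_pushFrame] at hdet
    obtain ⟨A, hA⟩ : ∃ A : E →L[ℝ] E, ∀ v, A v = mfderiv 𝓘(ℝ, E) J g x v := ⟨mfderiv 𝓘(ℝ, E) J g x, fun _ => rfl⟩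
    have hdetA : LinearMap.det (A : E →ₗ[ℝ] E) ≠ 0 := by
      have hAe : (A : E →ₗ[ℝ] E) = (mfderiv 𝓘(ℝ, E) J g x).toLinearMap := by
        apply LinearMap.ext; intro v; exact hA v
      rw [hAe]; exact hdet
    set L : E ≃L[ℝ] E := A.toContinuousLinearEquivOfDetNeZero hdetA with hL
    refine isLocalDiffeomorphAt_of_mfderiv isOpen_univ (mem_univ x) hg.contMDiffOn (by simp) L ?_
    apply ContinuousLinearMap.ext; intro v
    rw [hL, A.coe_toContinuousLinearEquivOfDetNeZero hdetA]
    exact (hA v).symm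
  exact isSmoothEmbedding_of_isLocalDiffeomorph hloc hinj (ContinuousLinearEquiv.refl ℝ E)

end LeftInverse

/-! ### The unit entrance charts reparametrised by the plane -/

namespace BasinPair.SaddleData

open Cobordism FourManifolds.Flow TracePolar

attribute [local instance] fact_finrank_euclideanSpace_succ

universe u

variable {W : Type u} [TopologicalSpace W] [T2Space W] [SecondCountableTopology W]
  [CompactSpace W] [ChartedSpace (EuclideanHalfSpace (2 + 1)) W] [IsManifold (𝓡∂ (2 + 1)) ∞ W]
  {g : W → ℝ} {ξA ξB : Π x : W, TangentSpace (𝓡∂ (2 + 1)) x} {P : BasinPair g ξA ξB} (Q : P.SaddleData)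

/-- Local notation for the model plane and space. -/
local notation "E2" => EuclideanSpace ℝ (Fin 2)
local notation "E3" => EuclideanSpace ℝ (Fin 3)

/-- The shrinking diffeomorphism `ℝ² ≅ B(0, r)` (Mathlib's `univBall`). [folklore] -/
def shrinkB (r : ℝ) : OpenPartialHomeomorph E2 E2 := OpenPartialHomeomorph.univBall (0 : E2) r

/-- **The unit entrance chart of the end `b` of `s`, reparametrised by the plane.** [cite: MilnorHCobordism1965, proof of Thm. 3.13] -/
def ue (r : ℝ) (s : SaddlePt 2 g) (b : Bool) (y : E2) : Metric.sphere (0 : E3) 1 := unitVec (Q.entDir s b (shrinkB r y))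

/-- **Its left inverse** `u ↦ shrink⁻¹ (entBack s (rad • u))`. [folklore] -/
def ueInv (r : ℝ) (s : SaddlePt 2 g) (u : Metric.sphere (0 : E3) 1) : E2 := (shrinkB r).symm (Q.entBack s (P.A.rad • (u : E3)))

variable {Q} {r : ℝ} (hr : 0 < r) (hrε : r ^ 2 < Q.ε ^ 2) {s : SaddlePt 2 g} (hk : (Q.DA s).k = 1)

/-- Unfolding `ue`. [folklore] -/
theorem ue_apply (r : ℝ) (s : SaddlePt 2 g) (b : Bool) (y : E2) : Q.ue r s b y = unitVec (Q.entDir s b (shrinkB r y)) := rfl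

/-- Unfolding `ueInv`. [folklore] -/
theorem ueInv_apply (r : ℝ) (s : SaddlePt 2 g) (u : Metric.sphere (0 : E3) 1) :
    Q.ueInv r s u = (shrinkB r).symm (Q.entBack s (P.A.rad • (u : E3))) := rfl

include hr in
/-- The shrink lands in the ball. [folklore] -/
theorem norm_shrinkB_lt (y : E2) : ‖shrinkB r y‖ < r := by
  have h := (shrinkB r).map_source (x := y) (by rw [shrinkB, OpenPartialHomeomorph.univBall_source]; exact mem_univ y)
  rw [shrinkB, OpenPartialHomeomorph.univBall_target _ hr, mem_ball_zero_iff] at h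
  exact h

include hr hrε in
/-- The shrink lands in the disc `‖z‖² < ε²`. [folklore] -/
theorem norm_shrinkB_sq_lt (y : E2) : ‖shrinkB r y‖ ^ 2 < Q.ε ^ 2 := by
  have h := norm_shrinkB_lt hr y
  have h0 : 0 ≤ ‖shrinkB r y‖ := norm_nonneg _
  nlinarith

/-- `shrinkB r 0 = 0`. [folklore] -/
@[simp] theorem shrinkB_zero (r : ℝ) : shrinkB r (0 : E2) = 0 := OpenPartialHomeomorph.univBall_apply_zero _ _

/-- `shrink⁻¹ ∘ shrink = id`. [folklore] -/
@[simp] theorem shrinkB_symm_apply (r : ℝ) (y : E2) : (shrinkB r).symm (shrinkB r y) = y :=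
  (shrinkB r).left_inv (by rw [shrinkB, OpenPartialHomeomorph.univBall_source]; exact mem_univ y)

include hr in
/-- `shrink ∘ shrink⁻¹ = id` on the ball. [folklore] -/
theorem shrinkB_apply_symm {z : E2} (hz : ‖z‖ < r) : shrinkB r ((shrinkB r).symm z) = z :=
  (shrinkB r).right_inv (by rw [shrinkB, OpenPartialHomeomorph.univBall_target _ hr, mem_ball_zero_iff]; exact hz)

/-- The shrink is smooth. [folklore] -/
theorem contDiff_shrinkB (r : ℝ) : ContDiff ℝ ∞ (shrinkB r) := OpenPartialHomeomorph.contDiff_univBall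

/-- The inverse shrink is smooth on the ball. [folklore] -/
theorem contDiffAt_shrinkB_symm {z : E2} (hz : ‖z‖ < r) : ContDiffAt ℝ ∞ (shrinkB r).symm z := by
  have h : ContDiffOn ℝ ∞ (shrinkB r).symm (ball (0 : E2) r) := OpenPartialHomeomorph.contDiffOn_univBall_symm
  exact h.contDiffAt (isOpen_ball.mem_nhds (mem_ball_zero_iff.2 hz))

/-- **The centre of the unit entrance chart is the unit core direction.** [folklore] -/
theorem ue_zero (r : ℝ) (b : Bool) : Q.ue r s b 0 = unitVec (Q.coreDir s b) := by
  rw [ue_apply, shrinkB_zero]; rfl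

include hr hrε hk in
/-- **`ueInv ∘ ue = id`.** [folklore] -/
theorem ueInv_ue (b : Bool) (y : E2) : Q.ueInv r s (Q.ue r s b y) = y := by
  have hy := Q.norm_shrinkB_sq_lt hr hrε y
  have hn : ‖Q.entDir s b (shrinkB r y)‖ = P.A.rad := Q.norm_entDir hk hy
  have hne : Q.entDir s b (shrinkB r y) ≠ 0 := by rw [← norm_ne_zero_iff, hn]; exact P.A.rad_pos.ne'
  rw [ueInv_apply, ue_apply, coe_unitVec hne, hn, smul_smul, mul_inv_cancel₀ P.A.rad_pos.ne', one_smul,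
    Q.entBack_entDir hk hy, shrinkB_symm_apply]

include hr hrε hk in
/-- **The unit entrance chart is smooth.** [folklore] -/
theorem contMDiff_ue (b : Bool) : ContMDiff 𝓘(ℝ, E2) (𝓡 2) ∞ (Q.ue r s b) := fun y => by
  have hy := Q.norm_shrinkB_sq_lt hr hrε y
  have hne : Q.entDir s b (shrinkB r y) ≠ 0 := by
    rw [← norm_ne_zero_iff, Q.norm_entDir hk hy]; exact P.A.rad_pos.ne'
  have h1 : ContMDiffAt 𝓘(ℝ, E2) 𝓘(ℝ, E2) ∞ (shrinkB r) y := (contDiff_shrinkB r).contDiffAt.contMDiffAt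
  have h2 : ContMDiffAt 𝓘(ℝ, E2) 𝓘(ℝ, E3) ∞ (Q.entDir s b) (shrinkB r y) := Q.contMDiffAt_entDir hk hy
  have h3 : ContMDiffAt 𝓘(ℝ, E3) (𝓡 2) ∞ unitVec (Q.entDir s b (shrinkB r y)) :=
    (contMDiffOn_unitVec _ hne).contMDiffAt (isOpen_ne.mem_nhds hne)
  exact h3.comp y (h2.comp y h1)

include hr hrε hk in
/-- **The left inverse is smooth at the image points.** [folklore] -/
theorem contMDiffAt_ueInv (b : Bool) (y : E2) : ContMDiffAt (𝓡 2) 𝓘(ℝ, E2) ∞ (Q.ueInv r s) (Q.ue r s b y) := by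
  have hy := Q.norm_shrinkB_sq_lt hr hrε y
  have hn : ‖Q.entDir s b (shrinkB r y)‖ = P.A.rad := Q.norm_entDir hk hy
  have hne : Q.entDir s b (shrinkB r y) ≠ 0 := by rw [← norm_ne_zero_iff, hn]; exact P.A.rad_pos.ne'
  have hval : P.A.rad • ((Q.ue r s b y : Metric.sphere (0 : E3) 1) : E3) = Q.entDir s b (shrinkB r y) := by
    rw [ue_apply, coe_unitVec hne, hn, smul_smul, mul_inv_cancel₀ P.A.rad_pos.ne', one_smul]
  have hmem : Q.entDir s b (shrinkB r y) ∈ Q.entDom s b (Q.ε ^ 2) := Q.entDir_mem_entDom hk le_rfl hy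
  have hsm : ContMDiffAt 𝓘(ℝ, E3) 𝓘(ℝ, E3) ∞ (fun v : E3 => P.A.rad • v) ((Q.ue r s b y : Metric.sphere (0 : E3) 1) : E3) :=
    (contDiff_const_smul P.A.rad).contDiffAt.contMDiffAt
  have h1 : ContMDiffAt (𝓡 2) 𝓘(ℝ, E3) ∞ (fun u : Metric.sphere (0 : E3) 1 => P.A.rad • (u : E3)) (Q.ue r s b y) :=
    ContMDiffAt.comp (g := fun v : E3 => P.A.rad • v) (f := fun u : Metric.sphere (0 : E3) 1 => (u : E3)) (Q.ue r s b y)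
      hsm (contMDiff_coe_sphere _)
  have h2 : ContMDiffAt 𝓘(ℝ, E3) 𝓘(ℝ, E2) ∞ (Q.entBack s) (P.A.rad • ((Q.ue r s b y : Metric.sphere (0 : E3) 1) : E3)) := by
    rw [hval]; exact Q.contMDiffAt_entBack hmem
  have hback : Q.entBack s (P.A.rad • ((Q.ue r s b y : Metric.sphere (0 : E3) 1) : E3)) = shrinkB r y := by
    rw [hval, Q.entBack_entDir hk hy]
  have h3 : ContMDiffAt 𝓘(ℝ, E2) 𝓘(ℝ, E2) ∞ (shrinkB r).symm (Q.entBack s (P.A.rad • ((Q.ue r s b y : Metric.sphere (0 : E3) 1) : E3))) := by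
    rw [hback]; exact (contDiffAt_shrinkB_symm (norm_shrinkB_lt hr y)).contMDiffAt
  exact ContMDiffAt.comp (g := (shrinkB r).symm) (f := fun u : Metric.sphere (0 : E3) 1 => Q.entBack s (P.A.rad • (u : E3)))
    (Q.ue r s b y) h3 (ContMDiffAt.comp (g := Q.entBack s) (f := fun u : Metric.sphere (0 : E3) 1 => P.A.rad • (u : E3))
      (Q.ue r s b y) h2 h1)

include hr hrε hk in
/-- **The unit entrance chart, followed by any diffeomorphism of the sphere, is a smooth embedding of
the plane.** [cite: LeeSmoothManifolds2013, Prop. 5.2] -/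
theorem isSmoothEmbedding_comp_ue (φ : Metric.sphere (0 : E3) 1 ≃ₘ⟮𝓡 2, 𝓡 2⟯ Metric.sphere (0 : E3) 1) (b : Bool) :
    Manifold.IsSmoothEmbedding 𝓘(ℝ, E2) (𝓡 2) ∞ (φ ∘ Q.ue r s b) := by
  refine isSmoothEmbedding_of_contMDiffAt_leftInverse (φ.contMDiff.comp (Q.contMDiff_ue hr hrε hk b)) (χ := Q.ueInv r s ∘ φ.symm)
    (fun y => ?_) (fun y => ?_)
  · have h1 : ContMDiffAt (𝓡 2) (𝓡 2) ∞ φ.symm ((φ ∘ Q.ue r s b) y) := φ.symm.contMDiff _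
    have h2 : ContMDiffAt (𝓡 2) 𝓘(ℝ, E2) ∞ (Q.ueInv r s) (φ.symm ((φ ∘ Q.ue r s b) y)) := by
      rw [comp_apply, φ.symm_apply_apply]; exact Q.contMDiffAt_ueInv hr hrε hk b y
    exact h2.comp _ h1
  · show Q.ueInv r s (φ.symm (φ (Q.ue r s b y))) = y
    rw [φ.symm_apply_apply, Q.ueInv_ue hr hrε hk]

include hr hrε hk in
/-- **The unit entrance chart is a smooth embedding of the plane.** [cite: LeeSmoothManifolds2013, Prop. 5.2] -/
theorem isSmoothEmbedding_ue (b : Bool) : Manifold.IsSmoothEmbedding 𝓘(ℝ, E2) (𝓡 2) ∞ (Q.ue r s b) := by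
  have h := Q.isSmoothEmbedding_comp_ue hr hrε hk (Diffeomorph.refl (𝓡 2) (Metric.sphere (0 : E3) 1) ∞) b
  exact h

end BasinPair.SaddleData

end Literature.Topology.FourManifolds
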